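import Literature.RepresentationTheory.Paul1998.MetaplecticCocycleSectionParity
import HarnessLib

/-!
# Paul 1998 (1.2.1), the `W`-side by the `V ↔ W` symmetry: «similarly, `Ũ(r, s)` is isomorphic to the
# `det^{(p−q)/2}`-cover of `U(r, s)`» — parity of `p − q` (kernel; 0 named facts)

Topic `RepresentationTheory/Paul1998`; namespace `Literature.RepresentationTheory.Paul1998.MetaplecticSplitting`.
Continuation of `Literature.RepresentationTheory.Paul1998.MetaplecticCocycleSectionParity` (the `V`-side: over
`ι_V U(P,Q) ⊂ Sp(V ⊗ W)` the metaplectic cover splits when `|R| ≡ |S| (2)`, and carries the `CocycleSection (|R|−|S|)`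
fields unconditionally when `|Q| = 1`) and of `Literature.RepresentationTheory.KonnoKonno2007.JunctionSwapSymmetry`
(the `V ↔ W` relabelling `swapIdx : DPIdx P Q R S ≃ DPIdx R S P Q` and `ι𝕎_swap_apply`: the junction map of the swapped
pair is the original one conjugated by `swapIdx`).  With the functoriality of `Mp^𝓢` under relabelling
(`Weil1964.ArchMetaplecticReindex`) the `W`-side statements are the `V`-side statements of the SWAPPED pair
`(U(R,S), U(P,Q))` transported along `swapIdx` — no new analysis.

* §1 `ι𝕎_swap_eq_reindexSp`: `ι𝕎_{RSPQ} (h, g) = reindexSp swapIdx⁻¹ (ι𝕎_{PQRS} (g, h))` (homomorphism form of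
  `ι𝕎_swap_apply`), whence `ι_W h = reindexSp (swapIdx R S P Q)⁻¹ (ι_V^{swapped} h)` (`ιW_eq_reindexSp_ιV_swap`);
* §2 **`exists_metaplectic_hom_ιW_of_even`**: `|P| + |Q|` even ⟹ the cover SPLITS over `ι_W U(R,S)` (a homomorphism
  `U(R,S) →* Mp^𝓢(𝕎)` over `ι_W` with metaplectic values; `Mp₂.exists_section_ιW_of_even`), and the
  `CocycleSection (|P|−|Q|)` fields hold with `σ = det^{(|P|−|Q|)/2}` (`exists_cocycleSectionW_of_even`);
* §3 **`exists_cocycleSectionW_of_odd_of_core`**: `|P| + |Q|` odd ⟹ the `CocycleSection (|P|−|Q|)` fields over `ι_W`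
  from the one-line core datum of `U(R,S)`; **`exists_cocycleSectionW_rankOne`**: unconditional for `|S| = 1` and
  EVERY `(P, Q)` — print's «similarly, `Ũ(r,s)` is isomorphic to the `det^{(p−q)/2}`-cover of `U(r,s)`»
  [Paul1998, §1.2 p. 389 L23] for `U(r,1)`.

* §4 THE COMPACT MEMBERS, NO PARITY AND NO HYPOTHESIS: **`exists_cocycleSectionV_compact`** (`Q = ∅`: `U(P,Q) = U(p)`
  compact, EVERY `(R,S)`) and **`exists_cocycleSectionW_compact`** (`S = ∅`, EVERY `(P,Q)`) — here `ι` lands in the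
  maximal compact `U(𝕎)` and Folland's `K̃ = det^{-1/2}`-cover (`MpK`, [Folland1989, Prop. (4.39)]) with its GENUINE
  character `det^{-1/2}` gives `τ` and `σ` outright; this contains the tree's `exists_cocycleSectionW_linearised`.

Everything here is PROVED (0 named facts, net debt 0); citations record provenance only.

## References

* [Paul1998] A. Paul, *Howe correspondence for real unitary groups*, J. Funct. Anal. 159 (1998) 384–431, §1.2
  (1.2.1)–(1.2.2) p. 389 L11–29.
* [Kudla1994] S. Kudla, *Splitting metaplectic covers of dual reductive pairs*, Israel J. Math. 87 (1994) 361–401, §1,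
  Prop. 4.1.
* [KonnoKonno2007] K. Konno, T. Konno, Kyushu J. Math. 61 (2007), §3.1 (3.1).
* [Folland1989] G. B. Folland, *Harmonic Analysis in Phase Space*, Princeton UP 1989, Prop. (4.39).
* [Adams2007] J. Adams, *The theta correspondence over ℝ*, World Scientific 2007, §3.
-/

set_option autoImplicit false
-- the index types `DPIdx P Q R S` are deep sums of products: instance synthesis needs room
set_option synthInstance.maxSize 1024

noncomputable section

open MeasureTheory Complex SchwartzMap
open scoped InnerProductSpace ComplexConjugate

namespace Literature.RepresentationTheory.Paul1998

namespace MetaplecticSplitting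

open Literature.Analysis.SegalBargmann Literature.RepresentationTheory.HeisenbergGroup
open Literature.NumberTheory.Weil1964 Literature.NumberTheory.Weil1964.MpS
open Literature.NumberTheory.Automorphic Literature.NumberTheory.Automorphic.UnitaryGroup
open Literature.RepresentationTheory.KonnoKonno2007 Literature.RepresentationTheory.KonnoKonno2007.RealDualPair

variable {P Q R S : Type*} [Fintype P] [DecidableEq P] [Fintype Q] [DecidableEq Q] [Fintype R] [DecidableEq R]
  [Fintype S] [DecidableEq S]

/-! ## 1. The junction map of the swapped pair, homomorphism form -/

/-- **`ι𝕎` is `V ↔ W` symmetric (homomorphism form)**: `ι𝕎_{RSPQ} (h, g) = reindexSp swapIdx⁻¹ (ι𝕎_{PQRS} (g, h))`.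
[cite: KonnoKonno2007, §3.1 (3.1)] -/
theorem ι𝕎_swap_eq_reindexSp (g : Ginf R S P Q) :
    ι𝕎 R S P Q g = reindexSp (swapIdx P Q R S).symm (ι𝕎 P Q R S (g.2, g.1)) := by
  apply Subtype.ext
  apply LinearEquiv.ext
  intro w
  rw [ι𝕎_swap_apply, coe_reindexSp_apply]
  simp only [reindexPV_apply, reindexPV_symm_apply, Equiv.symm_symm]

/-- **`ι_W` of the pair is `ι_V` of the swapped pair, relabelled**: `ι𝕎_{PQRS} (1, h) = reindexSp (swapIdx R S P Q)⁻¹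
(ι𝕎_{RSPQ} (h, 1))`. [cite: KonnoKonno2007, §3.1 (3.1); Paul1998, §1.1 (1.1.2)] -/
theorem ιW_eq_reindexSp_ιV_swap (h : UForm R S) :
    ι𝕎 P Q R S (1, h) = reindexSp (swapIdx R S P Q).symm (ι𝕎 R S P Q (h, 1)) :=
  ι𝕎_swap_eq_reindexSp (P := R) (Q := S) (R := P) (S := Q) ((1, h) : Ginf P Q R S)

/-! ## 2. The even case on the `W`-side -/

set_option maxHeartbeats 1600000 in -- deep index types: slow instance unification
/-- **THE EVEN CASE, `W`-side — the metaplectic double cover SPLITS over `ι_W U(R,S)` when `|P| ≡ |Q| (2)`**, for every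
`R, S`: there is a homomorphism `s : U(R,S) →* Mp^𝓢(𝕎)` over `ι_W` with metaplectic values.
[cite: Kudla1994, §1, Prop. 4.1; Paul1998, §1.2 (1.2.1) p. 389 L23] -/
theorem exists_metaplectic_hom_ιW_of_even (h : Even (Fintype.card P + Fintype.card Q)) :
    ∃ s : UForm R S →* MpS (DPIdx P Q R S), (∀ g, proj (s g) = ι𝕎 P Q R S (1, g)) ∧ ∀ g, IsMetaplectic (s g) := by
  obtain ⟨s₀, h₀, h₀'⟩ := exists_metaplectic_hom_ιV_of_even (P := R) (Q := S) (R := P) (S := Q) h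
  obtain ⟨s, hs, hs'⟩ := exists_hom_reindex (G := UForm R S) (swapIdx R S P Q).symm (fun g => ι𝕎 R S P Q (g, 1))
    s₀ h₀ h₀'
  exact ⟨s, fun g => by rw [hs, ιW_eq_reindexSp_ιV_swap], hs'⟩

/-- **… as a section of `pr : Mp₂(𝕎) → Sp(𝕎)` over `ι_W`.** [cite: Kudla1994, §1, Prop. 4.1; Paul1998, §1.2 (1.2.1) p. 389 L23] -/
theorem Mp₂.exists_section_ιW_of_even (h : Even (Fintype.card P + Fintype.card Q)) :
    ∃ s : UForm R S →* Mp₂ (DPIdx P Q R S), ∀ g, Mp₂.pr (s g) = ι𝕎 P Q R S (1, g) := by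
  obtain ⟨s, hs, hs'⟩ := exists_metaplectic_hom_ιW_of_even (P := P) (Q := Q) (R := R) (S := S) h
  exact ⟨s.codRestrict (Mp₂ _) fun g => Mp₂.mem_of_isMetaplectic (hs' g), fun g => hs g⟩

set_option maxHeartbeats 1600000 in -- deep index types: slow instance unification
/-- **THE EVEN CASE, `W`-side, in the `CocycleSection` currency**: for `|P| ≡ |Q| (2)` the fields of B08-1's
`CocycleSection (|P| − |Q|)` hold over `ι_W` with `τ` a homomorphism and `σ = det^{(|P|−|Q|)/2}`.
[cite: Paul1998, §1.2 (1.2.1) p. 389 L23; Kudla1994, Prop. 4.1] -/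
theorem exists_cocycleSectionW_of_even (h : Even (Fintype.card P + Fintype.card Q)) :
    ∃ (τ : UForm R S → MpS (DPIdx P Q R S)) (σ : UForm R S → ℂˣ),
      (∀ g, proj (τ g) = ι𝕎 P Q R S (1, g)) ∧ (∀ g, IsMetaplectic (τ g)) ∧
      (∀ g, σ g ^ 2 = Matrix.GeneralLinearGroup.det (g : GL (R ⊕ S) ℂ) ^ ((Fintype.card P : ℤ) - Fintype.card Q)) ∧
      ∀ g₁ g₂, τ g₁ * τ g₂ = (if σ g₁ * σ g₂ = σ (g₁ * g₂) then 1 else negOne) * τ (g₁ * g₂) := by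
  obtain ⟨τ₀, σ, h₀, h₀', hσ, hmul⟩ := exists_cocycleSectionV_of_even (P := R) (Q := S) (R := P) (S := Q) h
  obtain ⟨τ, hτ, hτ', hmul'⟩ := cocycle_reindex (G := UForm R S) (swapIdx R S P Q).symm
    (fun g => ι𝕎 R S P Q (g, 1)) τ₀ σ h₀ h₀' hmul
  exact ⟨τ, σ, fun g => by rw [hτ, ιW_eq_reindexSp_ιV_swap], hτ', hσ, hmul'⟩

/-! ## 3. The odd case and the unconditional rank-one statement on the `W`-side -/

set_option maxHeartbeats 1600000 in -- deep index types: slow instance unification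
/-- **THE ODD CASE, `W`-side**: for `|P| + |Q|` odd the `CocycleSection (|P|−|Q|)` fields over `ι_W` follow from the
one-line core datum of `U(R,S)` (the `CocycleSection 1` fields over `ι_V` of the pair `(U(R,S), U(1,0))`).
[cite: Paul1998, §1.2 (1.2.1)–(1.2.2) p. 389 L11–29; Kudla1994, Prop. 4.1] -/
theorem exists_cocycleSectionW_of_odd_of_core (hodd : Odd (Fintype.card P + Fintype.card Q))
    (hcore : ∃ (τ : UForm R S → MpS (DPIdx R S Unit (Fin 0))) (σ : UForm R S → ℂˣ),
      (∀ g, proj (τ g) = ι𝕎 R S Unit (Fin 0) (g, 1)) ∧ (∀ g, IsMetaplectic (τ g)) ∧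
      (∀ g, σ g ^ 2 = Matrix.GeneralLinearGroup.det (g : GL (R ⊕ S) ℂ) ^ (1 : ℤ)) ∧
      ∀ g₁ g₂, τ g₁ * τ g₂ = (if σ g₁ * σ g₂ = σ (g₁ * g₂) then 1 else negOne) * τ (g₁ * g₂)) :
    ∃ (τ : UForm R S → MpS (DPIdx P Q R S)) (σ : UForm R S → ℂˣ),
      (∀ g, proj (τ g) = ι𝕎 P Q R S (1, g)) ∧ (∀ g, IsMetaplectic (τ g)) ∧
      (∀ g, σ g ^ 2 = Matrix.GeneralLinearGroup.det (g : GL (R ⊕ S) ℂ) ^ ((Fintype.card P : ℤ) - Fintype.card Q)) ∧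
      ∀ g₁ g₂, τ g₁ * τ g₂ = (if σ g₁ * σ g₂ = σ (g₁ * g₂) then 1 else negOne) * τ (g₁ * g₂) := by
  obtain ⟨τ₀, σ, h₀, h₀', hσ, hmul⟩ :=
    exists_cocycleSectionV_of_odd_of_core (P := R) (Q := S) (R := P) (S := Q) hodd hcore
  obtain ⟨τ, hτ, hτ', hmul'⟩ := cocycle_reindex (G := UForm R S) (swapIdx R S P Q).symm
    (fun g => ι𝕎 R S P Q (g, 1)) τ₀ σ h₀ h₀' hmul
  exact ⟨τ, σ, fun g => by rw [hτ, ιW_eq_reindexSp_ιV_swap], hτ', hσ, hmul'⟩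

set_option maxHeartbeats 1600000 in -- deep index types: slow instance unification
/-- **PAUL 1998 (1.2.1), `W`-SIDE, AT `|S| = 1`, UNCONDITIONAL**: for `U(R,S)` with `|S| = 1` and EVERY first member
`U(P,Q)` there are `τ : U(R,S) → Mp^𝓢(𝕎)` over `ι_W` with metaplectic values and `σ : U(R,S) → ℂ^×`,
`σ² = det^{|P|−|Q|}`, the metaplectic cocycle of `τ` being the coboundary of `σ`: «similarly, `Ũ(r, s)` is isomorphic to
the `det^{(p−q)/2}`-cover of `U(r, s)`» — NO hypothesis. [cite: Paul1998, §1.2 (1.2.1) p. 389 L23; Kudla1994, Prop. 4.1] -/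
theorem exists_cocycleSectionW_rankOne [Subsingleton S] (r₀ : R) (s₀ : S) :
    ∃ (τ : UForm R S → MpS (DPIdx P Q R S)) (σ : UForm R S → ℂˣ),
      (∀ g, proj (τ g) = ι𝕎 P Q R S (1, g)) ∧ (∀ g, IsMetaplectic (τ g)) ∧
      (∀ g, σ g ^ 2 = Matrix.GeneralLinearGroup.det (g : GL (R ⊕ S) ℂ) ^ ((Fintype.card P : ℤ) - Fintype.card Q)) ∧
      ∀ g₁ g₂, τ g₁ * τ g₂ = (if σ g₁ * σ g₂ = σ (g₁ * g₂) then 1 else negOne) * τ (g₁ * g₂) := by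
  obtain ⟨τ₀, σ, h₀, h₀', hσ, hmul⟩ := exists_cocycleSectionV_rankOne (P := R) (Q := S) (R := P) (S := Q) r₀ s₀
  obtain ⟨τ, hτ, hτ', hmul'⟩ := cocycle_reindex (G := UForm R S) (swapIdx R S P Q).symm
    (fun g => ι𝕎 R S P Q (g, 1)) τ₀ σ h₀ h₀' hmul
  exact ⟨τ, σ, fun g => by rw [hτ, ιW_eq_reindexSp_ιV_swap], hτ', hσ, hmul'⟩

/-! ## 4. The compact members `U(P) = U(P, ∅)` and `U(R) = U(R, ∅)`: `K̃` does it, for EVERY partner and NO parity -/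

set_option maxHeartbeats 1600000 in -- deep index types: slow instance unification
/-- **`V`-SIDE FOR A COMPACT FIRST MEMBER, UNCONDITIONAL**: if `Q = ∅` (so `U(P,Q) = U(p)` is compact and
`ι_V U(p) ⊂ U(𝕎)`), then for EVERY `(R, S)` the `CocycleSection (|R|−|S|)` fields hold over `ι_V` — `τ(g)` the element of
Folland's `K̃ = det^{-1/2}`-cover over `ι_V g` (`MpK`, unconditional), `σ = det^{-1/2} ∘ pr` its genuine character; the
cocycle of `τ` is the coboundary of `σ` because `σ` is multiplicative on `K̃` and separates the two sheets.
[cite: Folland1989, Prop. (4.39); Adams2007, §3; Paul1998, §1.2 (1.2.1)–(1.2.2) p. 389 L11–29] -/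
theorem exists_cocycleSectionV_compact [IsEmpty Q] :
    ∃ (τ : UForm P Q → MpS (DPIdx P Q R S)) (σ : UForm P Q → ℂˣ),
      (∀ g, proj (τ g) = ι𝕎 P Q R S (g, 1)) ∧ (∀ g, IsMetaplectic (τ g)) ∧
      (∀ g, σ g ^ 2 = Matrix.GeneralLinearGroup.det (g : GL (P ⊕ Q) ℂ) ^ ((Fintype.card R : ℤ) - Fintype.card S)) ∧
      ∀ g₁ g₂, τ g₁ * τ g₂ = (if σ g₁ * σ g₂ = σ (g₁ * g₂) then 1 else negOne) * τ (g₁ * g₂) := by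
  -- every `g ∈ U(P, ∅)` is block-unitary: `g = kV k`, and `ι_V g = realifySp (dualPairι (k, 1))`
  choose kf hkf using fun g : UForm P Q => UForm.kV_surjective_of_isEmpty_right (α := P) (β := Q) g
  have hκ : ∀ g, κ P Q R S (kf g, 1) = (g, 1) := fun g => by
    show (UForm.kV P Q (kf g), UForm.kV R S 1) = (g, 1)
    rw [hkf, map_one]
  have hι : ∀ g, ι𝕎 P Q R S (g, 1) = realifySp (DPIdx P Q R S) (dualPairι (kf g, 1)) := fun g => by
    rw [← hκ, ι𝕎_κ]
  -- the two elements of `K̃` over it; pick one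
  choose x hxp using fun g : UForm P Q => MpK.exists_proj_eq_realifySp (σ := DPIdx P Q R S) (dualPairι (kf g, 1))
  have hdetg : ∀ g : UForm P Q, ((g : GL (P ⊕ Q) ℂ) : Matrix (P ⊕ Q) (P ⊕ Q) ℂ).det = ((kf g).1 : Matrix P P ℂ).det :=
    fun g => by
      have hb : (((kf g).2 : Matrix.unitaryGroup Q ℂ) : Matrix Q Q ℂ).det = 1 := Matrix.det_isEmpty
      conv_lhs => rw [← hkf g]
      rw [UForm.coe_kV, Matrix.det_fromBlocks_zero₂₁, hb, mul_one]
  refine ⟨fun g => (x g : MpS (DPIdx P Q R S)), fun g => MpK.vacChar (x g), fun g => by rw [hxp, hι],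
    fun g => MpK.isMetaplectic (x g), fun g => Units.ext ?_, fun g₁ g₂ => ?_⟩
  · -- `σ(g)² = det(g)^{|R|−|S|}`: `C(x)² · det(dualPairι (k,1)) = 1` and `det(dualPairι (k,1)) = det(a)^{|S|−|R|}`
    have h1 := MpK.vacChar_sq_mul_det (x g) (hxp g)
    rw [det_dualPairι, vacScalar] at h1
    simp only [Prod.fst_one, Prod.snd_one, OneMemClass.coe_one, Matrix.det_one, one_zpow, mul_one,
      Matrix.det_isEmpty] at h1
    rw [Units.val_pow_eq_pow_val, Units.val_zpow_eq_zpow_val, Matrix.GeneralLinearGroup.val_det_apply, hdetg]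
    have hne : ((kf g).1 : Matrix P P ℂ).det ≠ 0 := fun h => by
      have hn := norm_det_unitaryGroup (kf g).1
      rw [h, norm_zero] at hn
      exact zero_ne_one hn
    have h2 : ((kf g).1 : Matrix P P ℂ).det ^ ((Fintype.card S : ℤ) - Fintype.card R) =
        (((kf g).1 : Matrix P P ℂ).det ^ ((Fintype.card R : ℤ) - Fintype.card S))⁻¹ := by
      rw [← zpow_neg, neg_sub]
    rw [h2] at h1
    exact (mul_inv_eq_one₀ (zpow_ne_zero _ hne)).1 h1
  · -- the cocycle: `x₁ x₂` and `x₁₂` lie over the same point; `σ` multiplicative decides the sheet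
    dsimp only
    have hproj : proj ((x g₁ * x g₂ : MpK (DPIdx P Q R S)) : MpS (DPIdx P Q R S)) =
        proj (x (g₁ * g₂) : MpS (DPIdx P Q R S)) := by
      rw [Subgroup.coe_mul, map_mul, hxp, hxp, hxp, ← hι, ← hι, ← hι, ← map_mul, Prod.mk_mul_mk, mul_one]
    have hvmul : MpK.vacChar (x g₁) * MpK.vacChar (x g₂) = MpK.vacChar (x g₁ * x g₂) := (map_mul _ _ _).symm
    rcases MpK.eq_or_eq_negOne_mul hproj.symm with h | h
    · -- same sheet
      have hv : MpK.vacChar (x g₁) * MpK.vacChar (x g₂) = MpK.vacChar (x (g₁ * g₂)) := by rw [hvmul, h]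
      rw [if_pos hv, one_mul, ← Subgroup.coe_mul, h]
    · -- opposite sheets
      have hv : MpK.vacChar (x g₁) * MpK.vacChar (x g₂) ≠ MpK.vacChar (x (g₁ * g₂)) := by
        intro he
        rw [hvmul, h, map_mul] at he
        have h3 : (MpK.vacChar (⟨negOne, MpK.negOne_mem⟩ : MpK (DPIdx P Q R S)) : ℂ) = 1 := by
          have h4 := mul_right_cancel (he.trans (one_mul _).symm)
          have := congrArg (fun u : ℂˣ => (u : ℂ)) h4
          simpa using this
        rw [MpK.vacChar_negOne] at h3
        norm_num at h3
      rw [if_neg hv, ← Subgroup.coe_mul, h, Subgroup.coe_mul]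

set_option maxHeartbeats 1600000 in -- deep index types: slow instance unification
/-- **`W`-SIDE FOR A COMPACT SECOND MEMBER, UNCONDITIONAL**: if `S = ∅` (`U(R,S) = U(r)` compact) then for EVERY
`(P, Q)` the `CocycleSection (|P|−|Q|)` fields hold over `ι_W` (the `V`-side compact statement of the swapped pair,
relabelled along `swapIdx`).  This contains the tree's `exists_cocycleSectionW_linearised` (`|Q| = 1`, `R ≠ ∅`) with no
hypothesis at all. [cite: Folland1989, Prop. (4.39); Paul1998, §1.2 (1.2.1) p. 389 L23] -/
theorem exists_cocycleSectionW_compact [IsEmpty S] :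
    ∃ (τ : UForm R S → MpS (DPIdx P Q R S)) (σ : UForm R S → ℂˣ),
      (∀ g, proj (τ g) = ι𝕎 P Q R S (1, g)) ∧ (∀ g, IsMetaplectic (τ g)) ∧
      (∀ g, σ g ^ 2 = Matrix.GeneralLinearGroup.det (g : GL (R ⊕ S) ℂ) ^ ((Fintype.card P : ℤ) - Fintype.card Q)) ∧
      ∀ g₁ g₂, τ g₁ * τ g₂ = (if σ g₁ * σ g₂ = σ (g₁ * g₂) then 1 else negOne) * τ (g₁ * g₂) := by
  obtain ⟨τ₀, σ, h₀, h₀', hσ, hmul⟩ := exists_cocycleSectionV_compact (P := R) (Q := S) (R := P) (S := Q)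
  obtain ⟨τ, hτ, hτ', hmul'⟩ := cocycle_reindex (G := UForm R S) (swapIdx R S P Q).symm
    (fun g => ι𝕎 R S P Q (g, 1)) τ₀ σ h₀ h₀' hmul
  exact ⟨τ, σ, fun g => by rw [hτ, ιW_eq_reindexSp_ιV_swap], hτ', hσ, hmul'⟩

end MetaplecticSplitting

end Literature.RepresentationTheory.Paul1998

end
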